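import Summits.QuantumAdvantage.QuantumAdvantage.Theorems.CubicForrelationNearExactIsExactEighteenTypeO
import Summits.QuantumAdvantage.QuantumAdvantage.Theorems.CubicForrelationNearExactIsExactZeroModSixPrep

/-!
# Crux `CubicForrelation.NearExactIsExact` (stmt-QuantumAdvantage-14043) — type-O digits on `n = 6r` bits (general `r`):
  `d₁` affine, `d₂` cubic, and NO CASE A

Certificate seat `b2b-cforr-cert` (gen 8).  HONEST FRAMING: preparatory lemmas, uniform in `r`, for the theorem that on `n ≡ 0 (mod 6)`,
`n ≥ 18`, cubic pairs with `Φ ≥ 1 − 2^{−n/3}` are exact (the SECOND dyadic boundary of the two-sided analysis; `n = 18` is the tree's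
`isolation_eighteen_closed`).  Infinitely many finite-slice verdicts; NOT summit progress (the constants tend to `1`).

For a cubic `g : 𝔽₂^{3r+3r} → 𝔽₂`, `W_g = 2^{2r}u` (Ax).  This file is the `n = 18` file `…EighteenTypeO.lean` with `9 + 9` replaced by
`3r + 3r` throughout (the generic tiling lemmas of `…SaturatedTilings.lean` were already stated for every `n`):
* `z2_cube_sum`: `2^{2r}·Σ_{E_I} u = 2^{|I|}·2^{⌈(6r−|I|)/3⌉}·z` (Poisson over `E_I`, Ax on `E_{Iᶜ}`);
* `z2_digitOne`, `z2_digitTwo`: if every `u(x)` is odd (type O) then `d₁ = [⌊u/2⌋ odd]` is AFFINE and `d₂ = [⌊u/4⌋ odd]` is CUBIC;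
* `z2_no_caseA` (`r ≥ 1`): a type-O cubic never has `d₁ = d₂` everywhere (`u ≡ ±1 (mod 8)`): `u(0) ≡ N_{2r} (mod 2)` is odd (number of
  tilings of the `6r` variables by `2r` cubic monomials of `g`), the perfect-matching recursion yields a monomial `s₀ ∋ 0` with support
  `T`, `|T| = 3`, `N_{2r−1}(Tᶜ)` odd, whence `Σ_{E_T} u ≡ 4 (mod 8)` by Poisson; but `u ≡ 1 + 6d₁ (mod 8)` with `d₁` affine gives
  `Σ_{E_T} u ≡ 0 (mod 8)`.

References: J. Ax (1964) / R. J. McEliece (1972) (Carlet 2021 §4.1); MacWilliams–Sloane Ch. 13–15; R. O'Donnell, *Analysis of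
Boolean Functions* (2014) §1.4.  Everything below is proved from Mathlib and the tree; axioms are the standard three.
-/

set_option linter.dupNamespace false -- D-0017: single-problem summit ⇒ `QuantumAdvantage.QuantumAdvantage` by design

noncomputable section

namespace Summit.QuantumAdvantage.QuantumAdvantage.Theorems.CubicForrelation.NearExactIsExact

open Finset
open Literature.Computability.QuantumComplexity
open Literature.Computability.QuantumComplexity.BuzetChailloux (zeroVec)
open Literature.Computability.QuantumComplexity.DerivativeWalsh (W)

/-- The bias sum of a Boolean function over a coordinate cube through a representing polynomial (any `n`). [folklore] -/
theorem z2_bias_poly {n : ℕ} (g : (Fin n → Bool) → Bool) (p : MvPolynomial (Fin n) (ZMod 2)) (hrep : ∀ x, g x = polyPhase p x)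
    (K : Finset (Fin n)) :
    ∑ y ∈ {x : Fin n → Bool | ∀ i, x i = true → i ∈ K}, signOf (g y) =
      ((∑ y ∈ {x : Fin n → Bool | ∀ i, x i = true → i ∈ K},
        ∏ s ∈ p.support, (if (∀ j ∈ s.support, y j = true) then (-1 : ℤ) else 1) : ℤ) : ℝ) := by
  rw [Int.cast_sum]
  exact sum_congr rfl fun x _ => by rw [hrep x, ax_signOf_polyPhase]

section ZeroModSixDigits

variable (r : ℕ) (g : (Fin (3 * r + 3 * r) → Bool) → Bool) (u : (Fin (3 * r + 3 * r) → Bool) → ℤ)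

/-! ### Cube sums and the digits on `6r` bits -/

/-- The cube sums of `u = W_g/2^{2r}` for a cubic `g` on `6r` bits: `2^{2r}·Σ_{E_I} u = 2^{|I|}·2^{⌈(6r−|I|)/3⌉}·z` (Poisson over `E_I`,
Ax on `E_{Iᶜ}`). [cite: Carlet2020, §4.1] -/
theorem z2_cube_sum (hg : IsDegLeFun 3 g) (hu : ∀ x, W (fun y => signOf (g y)) x = (2 : ℝ) ^ (2 * r) * (u x : ℝ))
    (I : Finset (Fin (3 * r + 3 * r))) :
    ∃ z : ℤ, (2 : ℤ) ^ (2 * r) * ∑ x ∈ {x : Fin (3 * r + 3 * r) → Bool | ∀ i, x i = true → i ∈ I}, u x =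
      2 ^ #I * (2 ^ ((3 * r + 3 * r - #I + 2) / 3) * z) := by
  have hP := bb_poisson (fun y => signOf (g y)) I
  obtain ⟨z, hz⟩ := stub_axParity (3 * r + 3 * r) 3 g Iᶜ (by norm_num) hg
  have hj : #Iᶜ = 3 * r + 3 * r - #I := by rw [card_compl, Fintype.card_fin]
  rw [hj, show (3 * r + 3 * r - #I + 3 - 1) / 3 = (3 * r + 3 * r - #I + 2) / 3 by omega] at hz
  rw [sum_congr rfl fun x _ => hu x, ← mul_sum, hz] at hP
  refine ⟨z, ?_⟩
  have h' : (((2 : ℤ) ^ (2 * r) * ∑ x ∈ {x : Fin (3 * r + 3 * r) → Bool | ∀ i, x i = true → i ∈ I}, u x : ℤ) : ℝ) =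
      (((2 : ℤ) ^ #I * (2 ^ ((3 * r + 3 * r - #I + 2) / 3) * z) : ℤ) : ℝ) := by
    push_cast at hP ⊢
    linarith
  exact_mod_cast h'

/-- For type O the odd points of a cube are all of it: `#{x ∈ E_I : u odd} = 2^{|I|}`. -/
theorem z2_card_odd_cube (hodd : ∀ x, Odd (u x)) (I : Finset (Fin (3 * r + 3 * r))) :
    (#(({x : Fin (3 * r + 3 * r) → Bool | ∀ i, x i = true → i ∈ I} : Finset _).filter fun x => Odd (u x)) : ℤ) = 2 ^ #I := by
  rw [filter_true_of_mem fun x _ => hodd x, bb_card_cube]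
  push_cast
  rfl

/-- **Digit one (type O, `6r` bits).** If every `u(x)` is odd then `x ↦ [⌊u(x)/2⌋ odd]` is AFFINE (degree `≤ 1`): for `|I| ≥ 2`,
`Σ_{E_I} u ≡ 0 (mod 4)` and `Σ_{E_I} u = 2·Σ⌊u/2⌋ + 2^{|I|}`. [this work; cite: Carlet2020, §4.1 (McEliece)] -/
theorem z2_digitOne (hg : IsDegLeFun 3 g) (hu : ∀ x, W (fun y => signOf (g y)) x = (2 : ℝ) ^ (2 * r) * (u x : ℝ))
    (hodd : ∀ x, Odd (u x)) : IsDegLeFun 1 (fun x => decide (Odd (u x / 2))) := by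
  refine bb_moebius_isDegLeFun 1 _ fun I hI => ?_
  have hk : #I ≤ 3 * r + 3 * r := (card_le_univ I).trans_eq (Fintype.card_fin _)
  obtain ⟨z, hz⟩ := z2_cube_sum r g u hg hu I
  have h4 : (2 : ℤ) ^ 2 ∣ ∑ x ∈ {x : Fin (3 * r + 3 * r) → Bool | ∀ i, x i = true → i ∈ I}, u x :=
    sx_dvd_of_balance (by omega) hz
  have hsplit : ∑ x ∈ {x : Fin (3 * r + 3 * r) → Bool | ∀ i, x i = true → i ∈ I}, u x =
      2 * ∑ x ∈ {x : Fin (3 * r + 3 * r) → Bool | ∀ i, x i = true → i ∈ I}, u x / 2 + 2 ^ #I := by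
    rw [sum_congr rfl fun x _ => td_two_mul_div_add (u x), sum_add_distrib, ← mul_sum, td_sum_ite_odd,
      z2_card_odd_cube r u hodd I]
  obtain ⟨e, he⟩ : ∃ e, #I = e + 2 := ⟨#I - 2, by omega⟩
  have hE : Even (∑ x ∈ {x : Fin (3 * r + 3 * r) → Bool | ∀ i, x i = true → i ∈ I}, u x / 2) := by
    rw [pow_two] at h4
    obtain ⟨q, hq⟩ := h4
    rw [he, pow_add] at hsplit
    refine ⟨q - 2 ^ e, ?_⟩
    nlinarith
  have hE' := (tw_even_sum_iff _ (fun x => u x / 2)).1 hE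
  rw [filter_filter] at hE'
  simpa only [decide_eq_true_eq] using hE'

/-- **Digit two (type O, `6r` bits).** If every `u(x)` is odd then `x ↦ [⌊⌊u(x)/2⌋/2⌋ odd]` is CUBIC (degree `≤ 3`): for `|I| ≥ 4`,
`Σ_{E_I} u ≡ 0 (mod 8)`, `Σ_{E_I} u = 4·Σ⌊u/4⌋ + 2·#{d₁} + 2^{|I|}` and `#{d₁ on E_I} ∈ 4ℤ`. [this work] -/
theorem z2_digitTwo (hg : IsDegLeFun 3 g) (hu : ∀ x, W (fun y => signOf (g y)) x = (2 : ℝ) ^ (2 * r) * (u x : ℝ))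
    (hodd : ∀ x, Odd (u x)) : IsDegLeFun 3 (fun x => decide (Odd (u x / 2 / 2))) := by
  have hP1 := z2_digitOne r g u hg hu hodd
  refine bb_moebius_isDegLeFun 3 _ fun I hI => ?_
  have hk : #I ≤ 3 * r + 3 * r := (card_le_univ I).trans_eq (Fintype.card_fin _)
  obtain ⟨z, hz⟩ := z2_cube_sum r g u hg hu I
  have h8 : (2 : ℤ) ^ 3 ∣ ∑ x ∈ {x : Fin (3 * r + 3 * r) → Bool | ∀ i, x i = true → i ∈ I}, u x :=
    sx_dvd_of_balance (by omega) hz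
  obtain ⟨z'', hz''⟩ := td_count_cube (le_refl 1) (fun x => decide (Odd (u x / 2))) hP1 I
  rw [show (#I + 1 - 1) / 1 = #I by simp] at hz''
  have hB : (4 : ℤ) ∣ #{x : Fin (3 * r + 3 * r) → Bool | (∀ i, x i = true → i ∈ I) ∧ decide (Odd (u x / 2)) = true} := by
    obtain ⟨e, he⟩ : ∃ e, #I = e + 4 := ⟨#I - 4, by omega⟩
    rw [he, show (2 : ℤ) ^ (e + 4) = 2 ^ e * 16 by rw [pow_add]; norm_num] at hz''
    refine ⟨2 ^ e * 2 * (1 - z''), ?_⟩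
    linarith
  have hsplit : ∑ x ∈ {x : Fin (3 * r + 3 * r) → Bool | ∀ i, x i = true → i ∈ I}, u x =
      2 * (2 * ∑ x ∈ {x : Fin (3 * r + 3 * r) → Bool | ∀ i, x i = true → i ∈ I}, u x / 2 / 2 +
        #{x : Fin (3 * r + 3 * r) → Bool | (∀ i, x i = true → i ∈ I) ∧ decide (Odd (u x / 2)) = true}) + 2 ^ #I := by
    rw [sum_congr rfl fun x _ => td_two_mul_div_add (u x), sum_add_distrib, ← mul_sum, td_sum_ite_odd,
      z2_card_odd_cube r u hodd I, sum_congr rfl fun x _ => td_two_mul_div_add (u x / 2), sum_add_distrib, ← mul_sum,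
      td_sum_ite_odd, filter_filter]
    simp only [decide_eq_true_eq]
  obtain ⟨e, he⟩ : ∃ e, #I = e + 3 := ⟨#I - 3, by omega⟩
  have hE : Even (∑ x ∈ {x : Fin (3 * r + 3 * r) → Bool | ∀ i, x i = true → i ∈ I}, u x / 2 / 2) := by
    obtain ⟨q, hq⟩ := h8
    obtain ⟨b, hb⟩ := hB
    rw [hq, hb, he, pow_add] at hsplit
    refine ⟨q - b - 2 ^ e, ?_⟩
    nlinarith
  have hE' := (tw_even_sum_iff _ (fun x => u x / 2 / 2)).1 hE
  rw [filter_filter] at hE'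
  simpa only [decide_eq_true_eq] using hE'

/-! ### No case A on `6r` bits: the digits `d₁, d₂` differ somewhere -/

/-- **No case A on `6r` bits (`r ≥ 1`).** No cubic `g : 𝔽₂^{6r} → 𝔽₂` of type O has `[⌊u/2⌋ odd] = [⌊u/4⌋ odd]` everywhere (i.e.
every `W_g(x)/2^{2r} ≡ ±1 (mod 8)`): `u(0) ≡ N_{2r} (mod 2)` is odd, the recursion through the pivot `0` yields a monomial `s₀ ∋ 0` with
support `T`, `|T| = 3`, `N_{2r−1}(Tᶜ)` odd, so `Σ_{E_T} u ≡ 4 (mod 8)`; but `u ≡ 1 + 6d₁ (mod 8)` with `d₁` affine gives `0 (mod 8)`.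
Uniform in `r`. [this work] -/
theorem z2_no_caseA (hr : 1 ≤ r) (hg : IsDegLeFun 3 g)
    (hu : ∀ x, W (fun y => signOf (g y)) x = (2 : ℝ) ^ (2 * r) * (u x : ℝ))
    (hodd : ∀ x, Odd (u x)) (hA : ∀ x, Odd (u x / 2) ↔ Odd (u x / 2 / 2)) : False := by
  obtain ⟨p, hp, hrep⟩ := id hg
  have hd1 := z2_digitOne r g u hg hu hodd
  obtain ⟨k, rfl⟩ : ∃ k, r = k + 1 := ⟨r - 1, by omega⟩
  -- (1) `u(0) = N_{2r} + 2k`, so `N_{2r}` is odd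
  have hE0 : #({x : Fin (3 * (k + 1) + 3 * (k + 1)) → Bool |
      ∀ i, x i = true → i ∈ (∅ : Finset (Fin (3 * (k + 1) + 3 * (k + 1))))} : Finset _) = 1 := by
    rw [bb_card_cube, card_empty, pow_zero]
  obtain ⟨a, ha⟩ := card_eq_one.1 hE0
  have h0 := bb_poisson (fun y => signOf (g y)) (∅ : Finset (Fin (3 * (k + 1) + 3 * (k + 1))))
  rw [ha, sum_singleton, card_empty, pow_zero, one_mul, compl_empty, hu a, z2_bias_poly g p hrep univ] at h0
  obtain ⟨k₆, hk₆⟩ := st_cube_bias_congr p hp univ (2 * k + 1 + 1) (by rw [card_univ, Fintype.card_fin]; ring)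
  rw [hk₆] at h0
  set N₆ := #{S ∈ p.support.powerset | #S = 2 * k + 1 + 1 ∧ (S.biUnion fun s => s.support) = univ} with hN₆
  have h0z : (2 : ℤ) ^ (2 * (k + 1)) * u a = (-2) ^ (2 * k + 1 + 1) * (N₆ : ℕ) + 2 ^ (2 * k + 1 + 1 + 1) * k₆ := by
    exact_mod_cast h0
  have hpow2 : (-2 : ℤ) ^ (2 * k + 1 + 1) = 2 ^ (2 * k + 1 + 1) := Even.neg_pow ⟨k + 1, by ring⟩ 2
  rw [hpow2] at h0z
  have hua : u a = (N₆ : ℤ) + 2 * k₆ := by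
    have e : (2 : ℤ) ^ (2 * (k + 1)) * u a = 2 ^ (2 * (k + 1)) * ((N₆ : ℤ) + 2 * k₆) := by
      rw [h0z, show 2 * k + 1 + 1 = 2 * (k + 1) by ring, pow_succ]; ring
    exact mul_left_cancel₀ (by positivity) e
  have hN6 : ¬ Even N₆ := by
    rintro ⟨r', hr'⟩
    have hua' := Int.odd_iff.1 (hodd a)
    rw [hua, hr'] at hua'
    push_cast at hua'
    omega
  -- (2) some monomial `s₀ ∋ 0` with `|supp s₀| = 3` has `N_{2r−1}(univ ∖ supp s₀)` odd
  have hex : ∃ s₀ ∈ p.support, (0 : Fin (3 * (k + 1) + 3 * (k + 1))) ∈ s₀.support ∧ #s₀.support = 3 ∧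
      ¬ Even #{S' ∈ p.support.powerset | #S' = 2 * k + 1 ∧ (S'.biUnion fun s => s.support) = univ \ s₀.support} := by
    by_contra hall
    push Not at hall
    exact hN6 (st_even_saturated_succ p hp univ 0 (mem_univ _) (2 * k + 1) (by rw [card_univ, Fintype.card_fin]; ring)
      fun s₀ hs₀ h0 _ h3 => hall s₀ hs₀ h0 h3)
  obtain ⟨s₀, hs₀p, -, hT3, hodd5⟩ := hex
  set T := s₀.support with hT
  -- (3) Poisson over `E_T`: `Σ_{E_T} u = -4·N' + 8k'`
  have h1 := bb_poisson (fun y => signOf (g y)) T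
  rw [sum_congr rfl fun x _ => hu x, ← mul_sum, hT3, compl_eq_univ_sdiff, z2_bias_poly g p hrep (univ \ T)] at h1
  obtain ⟨k₅, hk₅⟩ := st_cube_bias_congr p hp (univ \ T) (2 * k + 1)
    (by rw [card_sdiff_of_subset (subset_univ _), card_univ, Fintype.card_fin, hT3]; omega)
  rw [hk₅] at h1
  set N₅ := #{S' ∈ p.support.powerset | #S' = 2 * k + 1 ∧ (S'.biUnion fun s => s.support) = univ \ T} with hN₅
  have h1z : (2 : ℤ) ^ (2 * (k + 1)) * ∑ x ∈ {x : Fin (3 * (k + 1) + 3 * (k + 1)) → Bool | ∀ i, x i = true → i ∈ T}, u x =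
      2 ^ 3 * ((-2) ^ (2 * k + 1) * (N₅ : ℕ) + 2 ^ (2 * k + 1 + 1) * k₅) := by
    exact_mod_cast h1
  have hpow3 : (-2 : ℤ) ^ (2 * k + 1) = -2 ^ (2 * k + 1) := Odd.neg_pow ⟨k, rfl⟩ 2
  rw [hpow3] at h1z
  have hsumT' : ∑ x ∈ {x : Fin (3 * (k + 1) + 3 * (k + 1)) → Bool | ∀ i, x i = true → i ∈ T}, u x =
      -4 * (N₅ : ℤ) + 8 * k₅ := by
    have e : (2 : ℤ) ^ (2 * (k + 1)) * ∑ x ∈ {x : Fin (3 * (k + 1) + 3 * (k + 1)) → Bool | ∀ i, x i = true → i ∈ T}, u x =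
        2 ^ (2 * (k + 1)) * (-4 * (N₅ : ℤ) + 8 * k₅) := by
      rw [h1z, show 2 * (k + 1) = 2 * k + 1 + 1 by ring, pow_succ, pow_succ]; ring
    exact mul_left_cancel₀ (by positivity) e
  obtain ⟨j, hj⟩ := Nat.not_even_iff_odd.1 hodd5
  -- (4) digits on `E_T`: `u = 8q + 1 + 6·[d₁]`, and `#{d₁ on E_T} = 4 − 4z'`
  have hpt : ∀ x, u x = 8 * (u x / 2 / 2 / 2) + 1 + 6 * (if Odd (u x / 2) then 1 else 0) := by
    intro x
    have e0 := td_two_mul_div_add (u x)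
    have e1 := td_two_mul_div_add (u x / 2)
    have e2 := td_two_mul_div_add (u x / 2 / 2)
    rw [if_pos (hodd x)] at e0
    by_cases h1 : Odd (u x / 2)
    · rw [if_pos h1] at e1 ⊢
      rw [if_pos ((hA x).1 h1)] at e2
      omega
    · rw [if_neg h1] at e1 ⊢
      rw [if_neg (fun h => h1 ((hA x).2 h))] at e2
      omega
  obtain ⟨z', hz'⟩ := td_count_cube (le_refl 1) (fun x => decide (Odd (u x / 2))) hd1 T
  rw [hT3, show (3 + 1 - 1) / 1 = 3 by norm_num] at hz'
  have hET : ((#({x : Fin (3 * (k + 1) + 3 * (k + 1)) → Bool | ∀ i, x i = true → i ∈ T} : Finset _) : ℕ) : ℤ) = 8 := by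
    rw [bb_card_cube T, hT3]
    norm_num
  have hsumT : ∑ x ∈ {x : Fin (3 * (k + 1) + 3 * (k + 1)) → Bool | ∀ i, x i = true → i ∈ T}, u x =
      8 * ∑ x ∈ {x : Fin (3 * (k + 1) + 3 * (k + 1)) → Bool | ∀ i, x i = true → i ∈ T}, (u x / 2 / 2 / 2) + 8 +
        6 * #{x : Fin (3 * (k + 1) + 3 * (k + 1)) → Bool | (∀ i, x i = true → i ∈ T) ∧ decide (Odd (u x / 2)) = true} := by
    rw [sum_congr rfl fun x _ => hpt x, sum_add_distrib, sum_add_distrib, ← mul_sum, ← mul_sum, sum_const, nsmul_eq_mul,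
      mul_one, hET, td_sum_ite_odd, filter_filter]
    simp only [decide_eq_true_eq]
  rw [hsumT, hj] at hsumT'
  push_cast at hsumT'
  omega

end ZeroModSixDigits

end Summit.QuantumAdvantage.QuantumAdvantage.Theorems.CubicForrelation.NearExactIsExact

end
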